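import Summits.MatrixMultiplication.OmegaCensus.STPPSmallPatternKernelSearch

/-!
# ω-census, `(2,1,1)^6` is infeasible in `ℤ/25` — kernel search, part 4 of 5

HONEST FRAMING (pub-omega census; verbatim): lottery ticket; floor = certified bounds/negative ranges.
Census STRUCTURE bookkeeping of the STPP track (seat pub-omega-eng2 = ENG2, gen 33, on the engine + reflection of seat pub-omega-stpp-3 gen 23; STRUCTURE row B5, the threshold column
`T1(H) = max {k : (2,1,1)^k ⊆ H}`, lower side), not progress on `ω`: small patterns in small groups bound no exponent.

Chunks of the kernel mask search `STPP211Neg.search (zcode 25) 6` (`decide +kernel`; ≈ 206 s of kernel time predicted at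
46 µs per mask translation of the mirrors); assembled in `STPPSmallPatternNone211K6Z25.lean`.

References: H. Cohn, R. Kleinberg, B. Szegedy, C. Umans, FOCS 2005 (arXiv:math/0511460), Def. 5.1.  Record: pub-omega HOME
`pub-omega-eng2-g33/results/none6/` (plans `cells/*.json|*.cost`: stpp-3's Python mirror `k211v3.py` and ENG2's C mirror `k211c.c` of the
kernel tree agree to the translation count; both COMPLETE NONE on these cells; farm calibration 46 µs per mask translation at
n = 29, k = 6; not used by the proofs).
-/

set_option Elab.async false  -- several kernel pieces: elaborate sequentially (memory)

namespace Summit.MatrixMultiplication.OmegaCensus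

namespace STPP211Neg

/-- Chunk list 13 of `ℤ/25`, `k = 6` (entries `(d, x1)`: representative `d` of `A₀ = {0,d}`, first-level exclusion mask;
1264454 mask translations in the mirror ≈ 58 s predicted). -/
def Z25k6.ch13 : List (ℕ × ℕ) := [(5, 33554423)]

/-- Kernel search over chunk list 13 of `ℤ/25`, `k = 6`. -/
theorem Z25k6.s13 : search (zcode 25) 6 Z25k6.ch13 = true := by
  decide +kernel

/-- Chunk list 14 of `ℤ/25`, `k = 6` (entries `(d, x1)`: representative `d` of `A₀ = {0,d}`, first-level exclusion mask;
1083274 mask translations in the mirror ≈ 50 s predicted). -/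
def Z25k6.ch14 : List (ℕ × ℕ) := [(5, 33554383)]

/-- Kernel search over chunk list 14 of `ℤ/25`, `k = 6`. -/
theorem Z25k6.s14 : search (zcode 25) 6 Z25k6.ch14 = true := by
  decide +kernel

/-- Chunk list 15 of `ℤ/25`, `k = 6` (entries `(d, x1)`: representative `d` of `A₀ = {0,d}`, first-level exclusion mask;
824092 mask translations in the mirror ≈ 38 s predicted). -/
def Z25k6.ch15 : List (ℕ × ℕ) := [(5, 33554367)]

/-- Kernel search over chunk list 15 of `ℤ/25`, `k = 6`. -/
theorem Z25k6.s15 : search (zcode 25) 6 Z25k6.ch15 = true := by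
  decide +kernel

/-- Chunk list 16 of `ℤ/25`, `k = 6` (entries `(d, x1)`: representative `d` of `A₀ = {0,d}`, first-level exclusion mask;
700007 mask translations in the mirror ≈ 32 s predicted). -/
def Z25k6.ch16 : List (ℕ × ℕ) := [(5, 33554303)]

/-- Kernel search over chunk list 16 of `ℤ/25`, `k = 6`. -/
theorem Z25k6.s16 : search (zcode 25) 6 Z25k6.ch16 = true := by
  decide +kernel

/-- Chunk list 17 of `ℤ/25`, `k = 6` (entries `(d, x1)`: representative `d` of `A₀ = {0,d}`, first-level exclusion mask;
600524 mask translations in the mirror ≈ 28 s predicted). -/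
def Z25k6.ch17 : List (ℕ × ℕ) := [(5, 33554175)]

/-- Kernel search over chunk list 17 of `ℤ/25`, `k = 6`. -/
theorem Z25k6.s17 : search (zcode 25) 6 Z25k6.ch17 = true := by
  decide +kernel

end STPP211Neg

end Summit.MatrixMultiplication.OmegaCensus
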